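import Literature.MathematicalPhysics.QuantumFieldTheory.Balaban1983to89.B12Normalization

/-!
# `BalabanUV.Beta.FP.HorizontalEnd` — road «FP» for binder row D1, leaf (H4) of the HORIZONTAL ROUTE (owner ruling R-FP-15,
# `HOME/b2b-balaban-beta-d1-p3/N7-PROOF.v2.md` §0/§4): the END OF THE ROUTE BY TYPE — bookkeeping (H1)+(H3) and the germ (H2) of ONE kernel give `hasym`

HONEST DEPENDENCY (page 1, mandatory): continuum YM on T⁴ ⇐ BetaPertH ∧ nine spine estimates (0/9 proved); BetaPertH ⇐ (D1) ∧ (D4) ∧ CAP+tail;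
G-an2-4 gates asym, D1 and NE2/3/4.  HONEST FRAMING (cell contract, verbatim): «discharging `BetaPertH` makes Bałaban's UV stability UNCONDITIONAL —
a real constructive-QFT result; it is NOT the continuum limit and NOT the Clay problem.»  THIS MODULE DISCHARGES NOTHING of the wall: pure real analysis
(Mathlib + the tree's `B12Normalization.stepBal_eq` for the name of the slope); every analytic input is a HYPOTHESIS with its supplier named; no `def`, no
`def … : Prop`, no cited fact, 0 sorry; 0 wall binders; NOT D1, NOT BetaPertH, NOT continuum, NOT Clay.

ABSOLUTE RULE (cell charter, verbatim): «No internally-minted statement may enter as a cited fact. Every hypothesis is either kernel-proved in this package or a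
verbatim quotation of a PUBLISHED theorem with page reference. The manuscript(s) under audit are NOT citable for their own disputed steps — they are the thing
under adjudication; programme-internal (2001/route/tribunal) claims are never citable.»

THE SHAPE.  `f m` := the road's perfect `m`-fold coefficient (`fPerfG … m = secondMoment (TP m) μ ν`, the one shot at blocking `n = Lc^m`); `g R` := the
WINDOWED second moment `M₂[Π·1_{‖z‖≤R}]` of the unconstrained perfect polarization `Π` (N7-PROOF.v2 (H2)); `s` := the slope.  Hypotheses:
* `hbook` — (H1)+(H3): `|f m − g (Lc^m)| ≤ U` for `m ≥ 1` (the horizontal identity `𝓘_nᵀΠ𝓘_n = T_n + Π^{[n]} + D_n` with its transport ∕ tail bookkeeping: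
  rows H1-KER (model level `FP/HorizontalModel`, kernel level = the shared composition lane) and H3-BOOK (leaf-02 lineage));
* `hgerm` — (H2-c): `|g R − (s·log R + c₀)| ≤ C` for `R ≥ 1` (germ `Π(z) = κ𝕋/‖z‖⁶ + O(‖z‖⁻⁷)` + the tree's shell arithmetic; row H2-OBJ, owner).
CONCLUSIONS: `hasym_of_horizontal` — `∀ m ≥ 1, |f m − m·(s·log Lc)| ≤ U + C + |c₀|`; `hasym_of_horizontal_stepBal` — at `s := 11N²/(12π²)` this is LITERALLY road FP's
binder `hasym : ∀ m ≥ 1, |fPerfG … m − m·stepBal N Lc| ≤ Cg` (`B12Normalization.stepBal_eq`), with `Cg := U + C + |c₀|`; `value_of_horizontal_step` — with (STEP)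
(`f (m+1) = f m + f 1`) the EXACT value `f 1 = s·log Lc` (so `= stepBal N Lc`): «uniqueness does the identification», no constant survives.
Provenance: road FP owner b2b-balaban-beta-d1-p3 gen 4 (prover-b2b-balaban-beta-d1-p3-g4-0), 2026-08-20.  [folklore], 0 def, 0 cite, 0 sorry.
-/

namespace Summit.QuantumFields.BalabanUV.Beta.FP.HorizontalEnd

open Literature.MathematicalPhysics.QuantumFieldTheory.Balaban1983to89
open B12Normalization (stepBal stepBal_eq)

/-- [folklore] **THE END OF THE HORIZONTAL ROUTE**: bookkeeping `|f m − g(L^m)| ≤ U` + windowed germ `|g R − (s·log R + c₀)| ≤ C` (`R ≥ 1`) ⟹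
`|f m − m·(s·log L)| ≤ U + C + |c₀|` for every `m ≥ 1` (`1 ≤ L`). -/
theorem hasym_of_horizontal {f : ℕ → ℝ} {g : ℝ → ℝ} {s U c₀ C : ℝ} {L : ℕ} (hL : 1 ≤ L)
    (hbook : ∀ m : ℕ, 1 ≤ m → |f m - g ((L : ℝ) ^ m)| ≤ U)
    (hgerm : ∀ R : ℝ, 1 ≤ R → |g R - (s * Real.log R + c₀)| ≤ C) :
    ∀ m : ℕ, 1 ≤ m → |f m - (m : ℝ) * (s * Real.log L)| ≤ U + C + |c₀| := by
  intro m hm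
  have hL1 : (1 : ℝ) ≤ (L : ℝ) := by exact_mod_cast hL
  have hR : (1 : ℝ) ≤ (L : ℝ) ^ m := one_le_pow₀ hL1
  have h1 := hbook m hm
  have h2 := hgerm ((L : ℝ) ^ m) hR
  have hlog : Real.log ((L : ℝ) ^ m) = (m : ℝ) * Real.log L := by
    rw [Real.log_pow]
  rw [hlog] at h2
  have e : f m - (m : ℝ) * (s * Real.log L)
      = (f m - g ((L : ℝ) ^ m)) + (g ((L : ℝ) ^ m) - (s * ((m : ℝ) * Real.log L) + c₀)) + c₀ := by ring
  rw [e]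
  calc |(f m - g ((L : ℝ) ^ m)) + (g ((L : ℝ) ^ m) - (s * ((m : ℝ) * Real.log L) + c₀)) + c₀|
      ≤ |(f m - g ((L : ℝ) ^ m)) + (g ((L : ℝ) ^ m) - (s * ((m : ℝ) * Real.log L) + c₀))| + |c₀| := abs_add_le _ _
    _ ≤ (|f m - g ((L : ℝ) ^ m)| + |g ((L : ℝ) ^ m) - (s * ((m : ℝ) * Real.log L) + c₀)|) + |c₀| := by
        gcongr; exact abs_add_le _ _
    _ ≤ U + C + |c₀| := by linarith

/-- [folklore] **THE SAME, IN THE CELL's CURRENCY**: with the slope `s := 11N²/(12π²)` the conclusion is road FP's binder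
`hasym : ∀ m ≥ 1, |f m − m·stepBal N Lc| ≤ Cg` with `Cg := U + C + |c₀|` (`B12Normalization.stepBal_eq`: `stepBal N L = (11N²/(12π²))·log L`). -/
theorem hasym_of_horizontal_stepBal {f : ℕ → ℝ} {g : ℝ → ℝ} {U c₀ C : ℝ} (N : ℝ) {Lc : ℕ} (hLc : 1 ≤ Lc)
    (hbook : ∀ m : ℕ, 1 ≤ m → |f m - g ((Lc : ℝ) ^ m)| ≤ U)
    (hgerm : ∀ R : ℝ, 1 ≤ R → |g R - (11 * N ^ 2 / (12 * Real.pi ^ 2) * Real.log R + c₀)| ≤ C) :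
    ∀ m : ℕ, 1 ≤ m → |f m - (m : ℝ) * stepBal N Lc| ≤ U + C + |c₀| := by
  intro m hm
  rw [stepBal_eq]
  exact hasym_of_horizontal hLc hbook hgerm m hm

/-- [folklore] **EXACTNESS FROM (STEP)** («uniqueness does the identification»): if moreover `f (m+1) = f m + f 1` for `m ≥ 1`, then `f 1 = s·log L` EXACTLY —
the bounded defect `U + C + |c₀|` is divided by `m → ∞`. -/
theorem value_of_horizontal_step {f : ℕ → ℝ} {g : ℝ → ℝ} {s U c₀ C : ℝ} {L : ℕ} (hL : 1 ≤ L)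
    (hbook : ∀ m : ℕ, 1 ≤ m → |f m - g ((L : ℝ) ^ m)| ≤ U)
    (hgerm : ∀ R : ℝ, 1 ≤ R → |g R - (s * Real.log R + c₀)| ≤ C)
    (hstep : ∀ m : ℕ, 1 ≤ m → f (m + 1) = f m + f 1) :
    f 1 = s * Real.log L := by
  have hasym := hasym_of_horizontal hL hbook hgerm
  -- `f m = m · f 1` for `m ≥ 1`
  have hpow : ∀ m : ℕ, 1 ≤ m → f m = (m : ℝ) * f 1 := by
    intro m hm
    induction m with
    | zero => omega
    | succ k ih =>
      rcases Nat.eq_zero_or_pos k with hk | hk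
      · subst hk; simp
      · rw [hstep k hk, ih hk]; push_cast; ring
  -- `|m · (f 1 − s log L)| ≤ K` for all `m ≥ 1` forces equality
  set K := U + C + |c₀| with hK
  have hbd : ∀ m : ℕ, 1 ≤ m → (m : ℝ) * |f 1 - s * Real.log L| ≤ K := by
    intro m hm
    have h := hasym m hm
    rw [hpow m hm, ← mul_sub, abs_mul, Nat.abs_cast] at h
    exact h
  by_contra hne
  have hpos : 0 < |f 1 - s * Real.log L| := abs_pos.mpr (sub_ne_zero.mpr hne)
  -- choose `m` with `m · |…| > K`
  obtain ⟨m, hm⟩ := exists_nat_gt (K / |f 1 - s * Real.log L|)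
  have hm1 : 1 ≤ m + 1 := by omega
  have h := hbd (m + 1) hm1
  have hlt : K < ((m : ℝ) + 1) * |f 1 - s * Real.log L| := by
    have := (div_lt_iff₀ hpos).mp hm
    nlinarith
  push_cast at h
  linarith

/-- [folklore] The cell's currency: (STEP) + the horizontal route ⟹ `f 1 = stepBal N Lc`. -/
theorem value_of_horizontal_step_stepBal {f : ℕ → ℝ} {g : ℝ → ℝ} {U c₀ C : ℝ} (N : ℝ) {Lc : ℕ} (hLc : 1 ≤ Lc)
    (hbook : ∀ m : ℕ, 1 ≤ m → |f m - g ((Lc : ℝ) ^ m)| ≤ U)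
    (hgerm : ∀ R : ℝ, 1 ≤ R → |g R - (11 * N ^ 2 / (12 * Real.pi ^ 2) * Real.log R + c₀)| ≤ C)
    (hstep : ∀ m : ℕ, 1 ≤ m → f (m + 1) = f m + f 1) :
    f 1 = stepBal N Lc := by
  rw [stepBal_eq]
  exact value_of_horizontal_step hLc hbook hgerm hstep

end Summit.QuantumFields.BalabanUV.Beta.FP.HorizontalEnd
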